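import Summits.QuantumFields.BalabanUV.Beta.GAN24.DerivativeRateTransferJensenMassFreeKarcherGauss
import Summits.QuantumFields.BalabanUV.Beta.GAN24.DerivativeRateTransferJensenMassFreeKarcherCommute

/-!
# `BalabanUV.Beta.GAN24.DerivativeRateTransferJensenMassFreeKarcherPhase` — binder row G-an2-4 ∕ (CONV-C), route R6 «VALUES, NOT DERIVATIVES», PART 86:
# THE DETERMINANT PHASE: THE `J`-TRACE OF THE SMALL LOGARITHM IS ADDITIVE, SO `SU(N)` DATA GIVE AN `SU(N)` KARCHER BASE — in the lineage's realified language
# (`U(N)` = the orthogonal matrices commuting with a complex structure `J`; for a `J`-commuting generator `Z` the imaginary part of the complex trace is carried by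
# `tr(J·Z)`), for `J`-commuting `A, E` in the window and `C = log(exp A·exp E)`:  **`tr(J·C) = tr(J·A) + tr(J·E)`** — the infinitesimal shadow of
# `det(eˣeʸ) = det eˣ·det eʸ`, proved WITHOUT determinants: along PART 78's curve `tr(J·f′) = tr(J·g(ad f)f′) = tr(J·E)` because `tr(J·[F,Y]) = 0` whenever `J`
# commutes with `F`; hence if the contour variables are special-unitary relative to the reference (`tr(J·log(τ_xτ₀ᵀ)) = 0`), so are the Karcher base `V` of
# (1.27) ∕ (1.29) and all its logarithms, and the (1.28) generator `Σq•A` (unit b2b-balaban-gan24-p3, gen 46; v1)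

NOT IN PRINT; OUR PROOF (for the ROUTE; PART 78 `exists_log_curve`, PART 79's series pattern (`hasSum_gSer_apply`, `hasSum_single`), PART 73 `commute_log_of_commute`,
PART 81 `exists_karcher_base_commute_of_transports`, PART 69 `exists_skew_log(s)_of_…`, PART 76 `log_unique` BY NAME; [folklore] `det ∘ exp = exp ∘ tr` — the tree's
`Literature.Analysis.Matrix.DetExp` proves it over a commutative Banach algebra; here only its trace-level shadow on the realified unitary group is needed and
proved directly).  HONEST FRAMING (cell contract, verbatim): «discharging `BetaPertH` makes Bałaban's UV stability UNCONDITIONAL — a real constructive-QFT result;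
it is NOT the continuum limit and NOT the Clay problem.»  HONEST DEPENDENCY (verbatim): «continuum YM on T⁴ ⇐ BetaPertH ∧ nine spine estimates (0/9 proved);
BetaPertH ⇐ (D1) ∧ (D4) ∧ CAP+tail; G-an2-4 gates asym, D1 and NE2/3/4.»

WHAT THIS FILE PROVES (0 sorry, 0 `def`, nothing cited): §1 `trace_mul_ad_of_commute` (`Commute J F → tr(J(FY − YF)) = 0`), **`trace_mul_gSer_ad_of_commute`**
(`tr(J·g(ad F)Y) = tr(J·Y)`), `commute_transpose_of_orthogonal`; §2 **`trace_J_log_mul`** (the additivity, for an orthogonal `J` commuting with `A, E`; no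
skewness needed); §3 `wsum_trace_J` ((1.28): `tr(J·Σq•A) = Σq·tr(J·A)`), **`karcher_phase_of_transports`** (`D ≤ 1∕800`, `J`-commuting orthogonal data whose
small logarithms relative to `τ₀` have `J`-trace zero ⟹ PART 81's Karcher base `V` and logarithms `C_x` satisfy `tr(J·C_x) = 0`, and every small logarithm of
`Vτ₀ᵀ` has `J`-trace zero).  HONEST SCOPE: the polar link (1.26) is NOT covered (Bałaban–Jaffe's «slightly modified polar decomposition» removes its phase by hand;
our `R′` of PART 58 is `U(N)`-valued only, PART 65); «special-unitary relative to `τ₀`» is the realified surrogate of `det = 1` (the complex determinant itself is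
not in the lineage's language); crude windows; ONE scale; NOT the tower, NOT (CONS), NOT (CONV-C).  SUPPLIER work on route R6 (rank 2, REDUCTION, no seat); no
consumer of record; NEVER «G-an2-4 closed»; NOT (CONV-C), NOT D1, NOT `BetaPertH`, NOT continuum, NOT Clay.  Records: `HOME/b2b-balaban-gan24-p3/WOODBURY-FIBRE.md` v14.6. -/

noncomputable section

open scoped Matrix Matrix.Norms.Frobenius NNReal Topology Nat
open NormedSpace Finset Matrix Metric Set

namespace Summit.QuantumFields.BalabanUV.Beta.GAN24.DerivativeRateTransferJensenMassFreeKarcherPhase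

open Literature.Analysis.Calculus.ExpDifferential
open Summit.QuantumFields.BalabanUV.Beta.GAN24.DerivativeRateTransferJensenMassFreePolarNear
open Summit.QuantumFields.BalabanUV.Beta.GAN24.DerivativeRateTransferJensenMassFreeExpTaylor (transpose_exp_of_skew)
open Summit.QuantumFields.BalabanUV.Beta.GAN24.DerivativeRateTransferJensenMassFreeLogarithm
open Summit.QuantumFields.BalabanUV.Beta.GAN24.DerivativeRateTransferJensenMassFreeLogarithmCommute
open Summit.QuantumFields.BalabanUV.Beta.GAN24.DerivativeRateTransferJensenMassFreeKarcherContraction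
open Summit.QuantumFields.BalabanUV.Beta.GAN24.DerivativeRateTransferJensenMassFreeLogChart
open Summit.QuantumFields.BalabanUV.Beta.GAN24.DerivativeRateTransferJensenMassFreeKarcherGauss
open Summit.QuantumFields.BalabanUV.Beta.GAN24.DerivativeRateTransferJensenMassFreeKarcherCommute

variable {o ν : Type*} [Fintype o] [DecidableEq o] [Fintype ν]

/-! ## §1 `tr(J·[F, Y]) = 0` whenever `J` commutes with `F` -/

omit [DecidableEq o] [Fintype ν] in
/-- `Commute J F → tr(J(FY − YF)) = 0`. [folklore] -/
theorem trace_mul_ad_of_commute {J F : Matrix o o ℝ} (h : Commute J F) (Y : Matrix o o ℝ) : Matrix.trace (J * (F * Y - Y * F)) = 0 := by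
  have h1 : Matrix.trace (J * (F * Y)) = Matrix.trace (F * (J * Y)) := by rw [← Matrix.mul_assoc, h.eq, Matrix.mul_assoc]
  have h2 : Matrix.trace (J * (Y * F)) = Matrix.trace (F * (J * Y)) := by rw [← Matrix.mul_assoc, Matrix.trace_mul_comm]
  rw [Matrix.mul_sub, Matrix.trace_sub, h1, h2, sub_self]

omit [Fintype ν] in
/-- **`trace_mul_gSer_ad_of_commute`** — `Commute J F → tr(J·g(ad F)Y) = tr(J·Y)` (the `g`-series term by term: every `(ad F)ⁿY`, `n ≥ 1`, is a commutator with
`F`). [folklore; PART 79's pattern] -/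
theorem trace_mul_gSer_ad_of_commute {J F : Matrix o o ℝ} (h : Commute J F) (Y : Matrix o o ℝ) :
    Matrix.trace (J * gSer ℝ (ad ℝ F) Y) = Matrix.trace (J * Y) := by
  let ψ := LinearMap.toContinuousLinearMap ((Matrix.traceLinearMap o ℝ ℝ).comp (LinearMap.mulLeft ℝ J))
  have hψ : ∀ X, ψ X = Matrix.trace (J * X) := fun X => rfl
  set G : ℕ → ℝ := fun n => ψ ((((-1 : ℝ) ^ n * ((n + 1)! : ℝ)⁻¹) • ad ℝ F ^ n) Y) with hG
  have hsum1 : HasSum G (ψ (gSer ℝ (ad ℝ F) Y)) := by exact ψ.hasSum (hasSum_gSer_apply F Y)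
  have hzero : ∀ n, n ≠ 0 → G n = 0 := by
    intro n hn
    obtain ⟨m, rfl⟩ := Nat.exists_eq_add_one_of_ne_zero hn
    simp only [hG, _root_.smul_apply, hψ, Matrix.mul_smul, Matrix.trace_smul, smul_eq_mul]
    rw [ad_pow_succ_apply, trace_mul_ad_of_commute h, mul_zero]
  have hG0 : G 0 = ψ Y := by
    simp only [hG, pow_zero, zero_add, Nat.factorial_one, Nat.cast_one, inv_one, mul_one, one_smul, one_apply_eq_self]
  have hsingle : HasSum G (ψ Y) := by
    rw [← hG0]
    exact hasSum_single 0 fun n hn => hzero n hn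
  have h' := hsum1.unique hsingle
  rwa [hψ, hψ] at h'

omit [Fintype ν] in
/-- an orthogonal `τ₀` commuting with `J` has `τ₀ᵀ` commuting with `J`. [folklore] -/
theorem commute_transpose_of_orthogonal {J τ₀ : Matrix o o ℝ} (hτ₀ : τ₀ᵀ * τ₀ = 1) (h : Commute J τ₀) : Commute J τ₀ᵀ := by
  have hτ₀' : τ₀ * τ₀ᵀ = 1 := mul_eq_one_comm.mp hτ₀
  have e : J * τ₀ᵀ = τ₀ᵀ * J := by
    calc J * τ₀ᵀ = τ₀ᵀ * τ₀ * J * τ₀ᵀ := by rw [hτ₀, Matrix.one_mul]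
      _ = τ₀ᵀ * (J * τ₀) * τ₀ᵀ := by rw [Matrix.mul_assoc τ₀ᵀ, ← h.eq]
      _ = τ₀ᵀ * J * (τ₀ * τ₀ᵀ) := by simp only [Matrix.mul_assoc]
      _ = τ₀ᵀ * J := by rw [hτ₀', Matrix.mul_one]
  exact e

/-! ## §2 The `J`-trace of the logarithm is additive -/

omit [Fintype ν] in
/-- **`trace_J_log_mul` — THE INFINITESIMAL DETERMINANT IDENTITY** [our proof]: `J` orthogonal commuting with `A` and `E` (`‖A‖ ≤ 1∕100`, `‖E‖ ≤ 1∕50`), `C` the small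
logarithm of `exp A·exp E` (`‖C‖ ≤ 1∕4`) ⟹ `tr(J·C) = tr(J·A) + tr(J·E)`.  Along PART 78's curve `f(t) = log(exp A·exp(tE))` (which commutes with `J`, PART 73) the
function `tr(J·f(t)) − t·tr(J·E)` has derivative `tr(J·f′) − tr(J·E) = tr(J·g(ad f)f′) − tr(J·E) = 0`. -/
theorem trace_J_log_mul {J A E C : Matrix o o ℝ} (hJ : Jᵀ * J = 1) (hJA : Commute J A) (hJE : Commute J E) (hA : ‖A‖ ≤ 1 / 100) (hE : ‖E‖ ≤ 1 / 50)
    (hC : ‖C‖ ≤ 1 / 4) (hCe : exp C = exp A * exp E) : Matrix.trace (J * C) = Matrix.trace (J * A) + Matrix.trace (J * E) := by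
  obtain ⟨f, f', hf0, hf⟩ := exists_log_curve (𝔸 := Matrix o o ℝ) hA hE
  have hfJ : ∀ t ∈ Icc (0 : ℝ) 1, Commute J (f t) := by
    intro t ht
    obtain ⟨h4, he, -, -, -⟩ := hf t ht
    have hG : Commute J (exp A * exp (t • E)) := (Commute.exp_right hJA).mul_right (Commute.exp_right (hJE.smul_right t))
    exact commute_log_of_commute hJ hG h4 he
  have h1 := hf 1 ⟨zero_le_one, le_rfl⟩
  have hC1 : C = f 1 := by
    refine log_unique hC h1.1 (hCe.trans (h1.2.1.trans ?_).symm)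
    rw [one_smul]
    rfl
  let trL := LinearMap.toContinuousLinearMap (Matrix.traceLinearMap o ℝ ℝ)
  let Φ₁ : ℝ → ℝ := fun t => Matrix.trace (J * f t) - t * Matrix.trace (J * E)
  have hΦ₁d : ∀ t ∈ Icc (0 : ℝ) 1, HasDerivAt Φ₁ (0 : ℝ) t := by
    intro t ht
    obtain ⟨-, -, hd, hgs, -⟩ := hf t ht
    have hg : HasDerivAt (fun t => J * f t) (J * f' t) t := hd.const_mul J
    have htr : HasDerivAt (fun t => Matrix.trace (J * f t)) (Matrix.trace (J * f' t)) t := (trL.hasFDerivAt).comp_hasDerivAt t hg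
    have hlin : HasDerivAt (fun t : ℝ => t * Matrix.trace (J * E)) (1 * Matrix.trace (J * E)) t := (hasDerivAt_id t).mul_const _
    refine (htr.sub hlin).congr_deriv ?_
    have hgauss : Matrix.trace (J * f' t) = Matrix.trace (J * E) :=
      (trace_mul_gSer_ad_of_commute (hfJ t ht) (f' t)).symm.trans (congrArg (fun X => Matrix.trace (J * X)) hgs)
    rw [hgauss, one_mul, sub_self]
  have h := norm_image_sub_le_of_norm_deriv_le_segment_01' (f := Φ₁) (C := 0)
    (fun s hs => (hΦ₁d s hs).hasDerivWithinAt) (fun s _ => by rw [norm_zero])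
  have h0 : Φ₁ 1 = Φ₁ 0 := sub_eq_zero.mp (norm_le_zero_iff.mp h)
  have e : Matrix.trace (J * f 1) - 1 * Matrix.trace (J * E) = Matrix.trace (J * f 0) - 0 * Matrix.trace (J * E) := h0
  rw [hf0, one_mul, zero_mul, sub_zero] at e
  rw [hC1]
  linarith

/-! ## §3 Special-unitary data give a special-unitary Karcher base and a traceless (1.28) generator -/

omit [DecidableEq o] in
/-- (1.28): the `J`-trace of the mean generator is the mean of the `J`-traces. [folklore] -/
theorem wsum_trace_J (J : Matrix o o ℝ) (q : ν → ℝ) (A : ν → Matrix o o ℝ) :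
    Matrix.trace (J * ∑ x, q x • A x) = ∑ x, q x * Matrix.trace (J * A x) := by
  rw [Matrix.mul_sum, Matrix.trace_sum]
  exact Finset.sum_congr rfl fun x _ => by rw [Matrix.mul_smul, Matrix.trace_smul, smul_eq_mul]

/-- **`karcher_phase_of_transports` — `SU(N)` CONTOUR VARIABLES GIVE AN `SU(N)` FEDERBUSH AVERAGE** [our proof]: weights `q ≥ 0`, `Σq = 1`; orthogonal transports `τ_x`
and reference `τ₀` with `‖τ_xτ₀ᵀ − 1‖ ≤ D ≤ 1∕800`, all commuting with an orthogonal `J`, and SPECIAL-UNITARY RELATIVE TO `τ₀`: every small logarithm of `τ_xτ₀ᵀ`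
has `J`-trace zero.  THEN PART 81's Karcher base `V` and logarithms `C_x` (commuting with `J`, `Σq•C = 0`) satisfy `tr(J·C_x) = 0` for all `x`, and every small
logarithm of `Vτ₀ᵀ` has `J`-trace zero. -/
theorem karcher_phase_of_transports {q : ν → ℝ} (hq : ∀ x, 0 ≤ q x) (hq1 : ∑ x, q x = 1) {τ : ν → Matrix o o ℝ} {τ₀ J : Matrix o o ℝ}
    (hτ : ∀ x, (τ x)ᵀ * τ x = 1) (hτ₀ : τ₀ᵀ * τ₀ = 1) {D : ℝ} (hD : ∀ x, ‖τ x * τ₀ᵀ - 1‖ ≤ D) (hD800 : D ≤ 1 / 800)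
    (hJ : Jᵀ * J = 1) (hJτ : ∀ x, Commute J (τ x)) (hJτ₀ : Commute J τ₀)
    (hsu : ∀ x (A : Matrix o o ℝ), ‖A‖ ≤ 1 / 4 → exp A = τ x * τ₀ᵀ → Matrix.trace (J * A) = 0) :
    ∃ (V : Matrix o o ℝ) (C : ν → Matrix o o ℝ), Vᵀ * V = 1 ∧ ‖V * τ₀ᵀ - 1‖ ≤ 8 * D ∧ (∀ x, (C x)ᵀ = -C x) ∧
      (∀ x, exp (C x) * V = τ x) ∧ (∀ x, ‖C x‖ ≤ 8 * D) ∧ ∑ x, q x • C x = 0 ∧ Commute J V ∧ (∀ x, Commute J (C x)) ∧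
      (∀ x, Matrix.trace (J * C x) = 0) ∧ ∀ B : Matrix o o ℝ, ‖B‖ ≤ 1 / 4 → exp B = V * τ₀ᵀ → Matrix.trace (J * B) = 0 := by
  obtain ⟨V, C, hV, hV1, hCt, hCe, hC8, h0, hJV, hJC⟩ := exists_karcher_base_commute_of_transports hq hq1 hτ hτ₀ hD hD800 hJ hJτ hJτ₀
  have hτ₀' : τ₀ * τ₀ᵀ = 1 := mul_eq_one_comm.mp hτ₀
  have hVt : V * Vᵀ = 1 := mul_eq_one_comm.mp hV
  have hJτ₀t : Commute J τ₀ᵀ := commute_transpose_of_orthogonal hτ₀ hJτ₀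
  have hVo : (V * τ₀ᵀ)ᵀ * (V * τ₀ᵀ) = 1 := by
    rw [transpose_mul, transpose_transpose, Matrix.mul_assoc, ← Matrix.mul_assoc Vᵀ, hV, Matrix.one_mul, hτ₀']
  obtain ⟨B, hBt, hB4, hB2, hBe⟩ := exists_skew_log_of_orthogonal hVo (hV1.trans (by linarith))
  have hB : ‖B‖ ≤ 1 / 50 := hB2.trans (by linarith)
  have hJB : Commute J B := commute_log_of_commute hJ (hJV.mul_right hJτ₀t) hB4 hBe
  obtain ⟨A, -, hA2, hA4, hAe⟩ := exists_skew_logs_of_transports hτ hτ₀ hD (by linarith)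
  have hA : ∀ x, ‖A x‖ ≤ 1 / 100 := fun x => (hA2 x).trans (by linarith)
  have hAG : ∀ x, exp (A x) = τ x * τ₀ᵀ := fun x => by rw [← hAe x, Matrix.mul_assoc, hτ₀', Matrix.mul_one]
  have hJA : ∀ x, Commute J (A x) := fun x => commute_log_of_commute hJ ((hJτ x).mul_right hJτ₀t) (hA4 x) (hAG x)
  have hsuA : ∀ x, Matrix.trace (J * A x) = 0 := fun x => hsu x (A x) (hA4 x) (hAG x)
  have hCAB : ∀ x, exp (C x) = exp (A x) * exp (-B) := fun x => by
    calc exp (C x) = exp (C x) * V * Vᵀ := by rw [Matrix.mul_assoc, hVt, Matrix.mul_one]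
      _ = τ x * Vᵀ := by rw [hCe x]
      _ = τ x * (τ₀ᵀ * τ₀) * Vᵀ := by rw [hτ₀, Matrix.mul_one]
      _ = (τ x * τ₀ᵀ) * (V * τ₀ᵀ)ᵀ := by rw [transpose_mul, transpose_transpose, Matrix.mul_assoc, Matrix.mul_assoc, Matrix.mul_assoc]
      _ = exp (A x) * exp (-B) := by rw [← hAG x, ← hBe, transpose_exp_of_skew hBt]
  have htr : ∀ x, Matrix.trace (J * C x) = -Matrix.trace (J * B) := fun x => by
    have h := trace_J_log_mul hJ (hJA x) hJB.neg_right (hA x) (by rw [norm_neg]; exact hB) ((hC8 x).trans (by linarith)) (hCAB x)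
    rw [hsuA x, Matrix.mul_neg, Matrix.trace_neg, zero_add] at h
    exact h
  have hB0 : Matrix.trace (J * B) = 0 := by
    have h := wsum_trace_J J q C
    rw [h0, Matrix.mul_zero, Matrix.trace_zero] at h
    simp only [htr, ← Finset.sum_mul, hq1, one_mul] at h
    linarith
  refine ⟨V, C, hV, hV1, hCt, hCe, hC8, h0, hJV, hJC, fun x => by rw [htr x, hB0, neg_zero], fun B' hB'4 hB'e => ?_⟩
  have e : B' = B := log_unique hB'4 hB4 (hB'e.trans hBe.symm)
  rw [e, hB0]

end Summit.QuantumFields.BalabanUV.Beta.GAN24.DerivativeRateTransferJensenMassFreeKarcherPhase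

end
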